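import Summits.HodgeConjecture.HodgeConjecture.Theorems.F0LD1ThetaGermDefs
import Literature.NumberTheory.Automorphic.HilbertRepIrreducibleOfDenseGerm
import HarnessLib

/-!
# Crux `HLiu418`, line LD1 — THE CLOSER OF THE LETTER (I′) `stub_letter_thetaIrr : ThetaSpaceIrreducible₂` MODULO THE ORGAN (G) `ThetaGerm₂`
# (irreducibility of the closed `(a′, ξ)`-theta span from a dense admissible irreducible germ; theorems only)

Cell `hodgecm-mathlib` (D-0151), FLOOR 0, half A line LD1 (socket `stub_S1_facts`, #73; leaf `Cruxes/HLiu418/Lines/F0_P6LD_StubS1FactsThetaRoad.lean`, ED. 6 to come),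
dealer LD1-plan (g2) DEALS #2 plate «GERM-DEFS + CLOSER» (b), seat LD1-p01 (g2), 2026-09-02.  THEOREMS ONLY; `--supports stmt-HodgeConjecture-24832`.  Pattern ★
`F0LD1ThetaCharRigidOfIrred.thetaCharRigid₂_of_irred` (restate the leaf's organ statement BY VALUE, no leaf import — the leaf will import this file).

THE STATEMENT **`thetaLiftFromLineIrreducible_of_thetaGerm₂ (hG : F0LD1ThetaGermDefs.ThetaGerm₂) : ‹the leaf's ThetaSpaceIrreducible₂, BY VALUE›`**: over the CM
curve frames of line LD1 (CM `L` with `[L:ℚ] ≥ 4`, `H` of signature `(1,1)` at `ι` and definite elsewhere, scaled frame `g, t, dV`, conjugate-symplectic `λ` of weight one,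
pinned transport `ιA`, compact `[U(diag dV)]`), for every line `a′` and character `ξ` of `[U(⟨a′⟩)]`: ★ `Liu2021.ThetaLiftFromLineIrreducible L 2 H e₁ dV … ιA μ λ … a′ ξ` — the
closed span of the `(a′, ξ)`-theta classes in `L²([U(H)], μ)` is `0` or topologically irreducible ([Liu2021, App. B Cor. B.6 (1) first clause] = [Wu2013, Thm. 5.3]).
PROOF (= LD1-plan (g2)'s skeleton v3 §4, kernel-checked there against the leaf's letter BY NAME): read (I′) through ★ `thetaLiftFromLineIrreducible_iff_classSet`; take the
germ `S` of (G) for `(a′, ξ)`; if `S = ⊥` the closed span is `closure {0} = {0}` and `Q = ⊥`; else the admissible non-zero slice `E` and ★ ORGAN (D)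
`ContRepresentation.ClosedSubrep.isTopIrreducible_of_denseSubmoduleGerm` (LD1-p01 (g2), p850456; `R_μ` is unitary: ★ `AdelicGroupData.isUnitary_rightRegular`) give
`Q` irreducible.  The leaf's ED. 6 then reads `theorem stub_organ_thetaGerm : F0LD1ThetaGermDefs.ThetaGerm₂ := by sorry` +
`theorem stub_letter_thetaIrr : ThetaSpaceIrreducible₂ := F0LD1ThetaIrrOfGerm.thetaLiftFromLineIrreducible_of_thetaGerm₂ stub_organ_thetaGerm`.

HONEST LABEL.  Nothing printed is discharged here: (I′)'s non-elementary content sits in the organ (G) = (Gα) local-global theta dichotomy + (Gβ) admissible slice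
(★ `F0LD1ThetaGermDefs`); HC_CM is proved only modulo the 7 printed citations (2 remaining: hLiu418 = stmt-HodgeConjecture-24832, h413 = stmt-HodgeConjecture-24833) until rung
0 closes; count-neutral.

References: [Liu2021] Y. Liu, Camb. J. Math. 9 (2021), App. B Cor. B.6 (1) p. 99; [Wu2013] C. Wu, J. Number Theory 133 (2013), Thm. 5.3; [Rallis1984] §1; [Dixmier1977] §5.4, §13.1.
-/

set_option autoImplicit false
set_option linter.dupNamespace false

noncomputable section

open NumberField NumberField.InfinitePlace MeasureTheory IsDedekindDomain
open scoped Matrix ComplexOrder ENNReal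
open Literature.NumberTheory.Automorphic Literature.NumberTheory.Automorphic.UnitaryGroup
open Literature.NumberTheory.Automorphic.UnitaryGroup.CotangentForms (toQuotFun)
open Literature.NumberTheory.Automorphic.UnitaryCurveForms
open Literature.NumberTheory.Automorphic.Liu2021 Literature.NumberTheory.Automorphic.Liu2021.Def411WeilCarriers
open Literature.NumberTheory.Automorphic.Liu2021.Def411WeilCarriersDoubling
open Literature.NumberTheory.GaloisRepresentations Literature.NumberTheory.Automorphic.IdeleClassGroup
open Literature.NumberTheory.GelbartRogawski1991 Literature.NumberTheory.GelbartRogawski1991.UnitaryDualPair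
open Literature.NumberTheory.GelbartRogawski1991.UnitaryDualPair.WeilCoinv
open Literature.NumberTheory.Weil1964
open Literature.RepresentationTheory.Liu2021 Literature.RepresentationTheory.HarrisKudlaSweet1996
open Literature.RepresentationTheory.CompactGroups
open Literature.NumberTheory.Rogawski1990
open Summit.HodgeConjecture.HodgeConjecture.Cruxes.HLiu418.F0LD1ThetaGermDefs

namespace Summit.HodgeConjecture.HodgeConjecture.Cruxes.HLiu418.F0LD1ThetaIrrOfGerm

set_option maxHeartbeats 1600000 in -- the frame binders + the theta class set terms (as the skeleton's §4)
/-- **(I′) FROM THE ORGAN (G)** — the leaf's `ThetaSpaceIrreducible₂` BY VALUE: over the CM curve frames, for every line `a′` and character `ξ`, the closed span of the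
`(a′, ξ)`-theta classes in `L²([U(H)])` is `0` or topologically irreducible (★ `Liu2021.ThetaLiftFromLineIrreducible`), GIVEN the theta germ package `ThetaGerm₂`.
Proof: germ `S = ⊥` ⇒ span `= {0}` ⇒ `Q = ⊥`; else ★ organ (D) `isTopIrreducible_of_denseSubmoduleGerm` on the unitary `R_μ` with the admissible non-zero slice.
[cite: Liu2021, App. B Cor. B.6 (1) (p. 99)] [cite: Wu2013, Thm. 5.3] [cite: Dixmier1977, §5.4] -/
theorem thetaLiftFromLineIrreducible_of_thetaGerm₂ (hG : ThetaGerm₂) :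
  ∀ (L : Type) [Field L] [NumberField L] [IsCMField L] (ι : L →+* ℂ) (H : Matrix (Fin 2) (Fin 2) L)
      (dV : Fin 2 → L) (hdV : ∀ i, IsCMField.complexConj L (dV i) = dV i) (hdV0 : ∀ i, dV i ≠ 0)
      (t : L) (ht : t ≠ 0) (g : GL (Fin 2) L)
      (_hg : formCongr ((IsCMField.complexConj L : L ≃ₐ[↥(maximalRealSubfield L)] L) : L →+* L) g (t • H) = Matrix.diagonal dV),
      (∃ T : GL (Fin 2) ℂ, formCongr (starRingEnd ℂ) T ((Matrix.diagonal dV).map ι) = Matrix.diagonal ![(1 : ℂ), -1]) →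
      (∀ τ' : L →+* ℂ, InfinitePlace.mk τ' ≠ InfinitePlace.mk ι → ((Matrix.diagonal dV).map τ').PosDef) →
      4 ≤ Module.finrank ℚ L →
      ∀ (μ : Measure (adelicGroupData (↥(maximalRealSubfield L)) L (IsCMField.complexConj L) 2 H).automorphicQuotient)
        [(adelicGroupData (↥(maximalRealSubfield L)) L (IsCMField.complexConj L) 2 H).IsAutomorphicMeasure μ]
        {n' : ℕ} (e₁ : Fin 2 × Fin 1 ≃ Fin n')
        (lam : Literature.NumberTheory.Automorphic.IdeleClassGroup L →ₜ* Circle) (hlam : IsConjugateSymplectic L lam), HasWeight L lam 1 →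
      ∀ (ιA : (adelicGroupData (↥(maximalRealSubfield L)) L (IsCMField.complexConj L) 2 H).Adelic →*
          ↥(UnitaryGroup.adelic (↥(maximalRealSubfield L)) L (IsCMField.complexConj L) 2 (Matrix.diagonal dV))),
        (∀ k, ((ιA k : ↥(UnitaryGroup.adelic (↥(maximalRealSubfield L)) L (IsCMField.complexConj L) 2 (Matrix.diagonal dV))) :
              GL (Fin 2) (AdeleRing (𝓞 L) L)) =
            (toAdeleGL L g)⁻¹ * adelicVal (↥(maximalRealSubfield L)) L (IsCMField.complexConj L) 2 H k * toAdeleGL L g) →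
      ∀ [CompactSpace (↥(UnitaryGroup.adelic (↥(maximalRealSubfield L)) L (IsCMField.complexConj L) 2 (Matrix.diagonal dV)) ⧸
          (UnitaryGroup.toAdelic (↥(maximalRealSubfield L)) L (IsCMField.complexConj L) 2 (Matrix.diagonal dV)).range)],
      ∀ (a' : (↥(maximalRealSubfield L))ˣ)
        (ξ : haveI := normal_range_toAdelic_JW L a'
          PontryaginDual (↥(UnitaryGroup.adelic (↥(maximalRealSubfield L)) L (IsCMField.complexConj L) 1 (JW (↥(maximalRealSubfield L)) L a')) ⧸ (UnitaryGroup.toAdelic (↥(maximalRealSubfield L)) L (IsCMField.complexConj L) 1 (JW (↥(maximalRealSubfield L)) L a')).range)),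
        ThetaLiftFromLineIrreducible L 2 H e₁ dV hdV hdV0 ιA μ lam hlam a' ξ := by
  intro L _ _ _ ι H dV hdV hdV0 t ht g hg hι hdef hdeg μ _ n' e₁ lam hlam hw ιA hιA _ a' ξ
  rw [thetaLiftFromLineIrreducible_iff_classSet]
  intro Q hQ
  obtain ⟨S, hS, hgerm, hslice⟩ := hG L ι H dV hdV hdV0 t ht g hg hι hdef hdeg μ e₁ lam hlam hw ιA hιA a' ξ
  rcases hslice with hS0 | ⟨E, hE, hES, hfin, hE0⟩
  · -- the germ is `0`: the closed span is `closure {0} = {0}`, so `Q = ⊥`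
    left
    subst hS0
    have h0 : (Q.toSubmodule : Set ((adelicGroupData (↥(maximalRealSubfield L)) L (IsCMField.complexConj L) 2 H).L2 μ)) = {0} := by
      rw [hQ, ← hS, Submodule.bot_coe, closure_singleton]
    exact le_bot_iff.mp fun v hv => by
      have hv' : v ∈ (Q.toSubmodule : Set ((adelicGroupData (↥(maximalRealSubfield L)) L (IsCMField.complexConj L) 2 H).L2 μ)) := hv
      rw [h0] at hv'
      exact (Submodule.mem_bot ℂ).2 (Set.mem_singleton_iff.1 hv')
  · -- an admissible non-zero slice: ★ organ (D) on the unitary right regular representation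
    right
    exact ContRepresentation.ClosedSubrep.isTopIrreducible_of_denseSubmoduleGerm (AdelicGroupData.isUnitary_rightRegular _ μ) Q S
      (hS.trans hQ.symm) hgerm E hE hES hfin hE0

end Summit.HodgeConjecture.HodgeConjecture.Cruxes.HLiu418.F0LD1ThetaIrrOfGerm

end
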